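import Summits.QuantumFields.BalabanUV.Beta.FP.PeriodisedBorderIndexWard
import Summits.QuantumFields.BalabanUV.Beta.FP.PeriodisedWardOrderZero

/-!
# `BalabanUV.Beta.PeriodisedIndexLawSummable` — binder row D1 (OWNER an2), (J-a) dictionary, periodisation engine: **A BLOCK-COVARIANT, EXPONENTIALLY
# LOCALISED TABLE FAMILY WITH AN INDEX-SLOT LAW, INSERTED ALONG A TORUS PURE GAUGE AND PERIODISED — THE ℓ¹ TWIN OF leaf-05's
# `FP/PeriodisedBorderIndexWard` §1** (finite support `hS hT hqS` replaced by bi-localisation at the bond; the exchanges are Fubini)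

WHY.  The (β) door of road «FP» (leaf-02 `FP/NestedStepLawTorusTransportedRowsGraded*Sym`) displays torus rows — `k1`-type index laws `Σ_b (Dλ)_b • Φ b = …`
and parities `(Φ b)ᵀ = −Φ b` — for the periodised first-order families of the literal of record.  leaf-05's §1 periodises a family whose members and contact
kernel are FINITELY SUPPORTED (the Wilson and border tables); the literal's Λ-sector (`InterLevelTransport.SLam`, `locStencil_SLam`) and its form slot at level
`j ≥ 1` (`e3OfK`, `locStencil_e3OfK`) are EXPONENTIALLY LOCALISED with (for the form slot) a non-finitely-supported contact.  This file is the engine for them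
(consumers: `CombLamSectorPeriodised`, `CombFormSlotPeriodised`).

CONTENT ([folklore] bookkeeping over OUR typed objects BY NAME; no `def`, no `def … : Prop`, nothing cited, 0 sorry): `tsum_sum_dz_mul_eq_of_bdd` (summation by
parts over `ℤ^{d+1}` for an ℓ¹ family against a BOUNDED potential — gan24-p2's `BorderGaugeLegContact.tsum_sum_dz_mul_eq` asks summability against every potential,
i.e. finite support); `tsum_sum_dz_mul_family_of_indexLaw_summable`; **`sum_tgrad_mul_dper_of_indexLaw_summable`** and **`sum_tgrad_mul_perZ_dper_of_indexLaw_summable`**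
= leaf-05's two §1 theorems with `hS hT` replaced by `hV : ∀ κ u, BiLoc (V κ u) u u C δ` (`0 ≤ C`, `0 < δ`) and `hqS` dropped (the contact kernel's period sum leaves
the prefactor by `tsum_mul_left`, convergent or not); the two exchanges are Fubini over box × period lattice for an ℓ¹ family (gan24-p3's
`KernelPeriodisationFibTrace.tsum_sites_eq_sum_tsum`, `KernelPeriodisationFibLoc.summable_exp_l1_translate ∕ decays_dper_diag`, `KernelPeriodisationFib.summable_translate_of_decays`);
`sum_tgrad_mul_perZ_dper_eq_zero_of_divV_eq_zero` (gauge-NULL families: an1's `KernelWard.divV V ≡ 0`, contact `0`; the two `unitVec` conventions bridged inline);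
`perF_dper_transpose_of_trF` (a fibre-transpose-odd member periodises to an antisymmetric matrix — leaf-05's `PeriodisedFormIndexWardDoubled.perF_dper_wilsonA_transpose`
made generic); **`torus_indexLaw_ff_of_divV_eq_zero`** (the (β) door's `hΛ` SHAPE for ANY block-covariant, localised, gauge-null family, any weight, any torus
gauge function).  0 estimates beyond the [folklore] summabilities; 0∕4 row-D1 binders; `D1Tel` ∕ `D1Rep` OPEN; NOT (T-ID), NOT (J-a) complete, NOT D1, NEVER
«G-an2-4 closed», NOT BetaPertH, NOT continuum, NOT Clay.

HONEST DEPENDENCY (page 1, mandatory): continuum YM on T⁴ ⇐ BetaPertH ∧ nine spine estimates (0/9 proved); BetaPertH ⇐ (D1) ∧ (D4) ∧ CAP+tail;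
G-an2-4 gates asym, D1 and NE2/3/4.  HONEST FRAMING (cell contract, verbatim): «discharging `BetaPertH` makes Bałaban's UV stability UNCONDITIONAL —
a real constructive-QFT result; it is NOT the continuum limit and NOT the Clay problem.»  ABSOLUTE RULE (cell charter, verbatim): «No internally-minted
statement may enter as a cited fact. Every hypothesis is either kernel-proved in this package or a verbatim quotation of a PUBLISHED theorem with page
reference. The manuscript(s) under audit are NOT citable for their own disputed steps — they are the thing under adjudication; programme-internal
(2001/route/tribunal) claims are never citable.»  Row D1 OWNER an2 (b2b-balaban-beta-an2) gen 41, 2026-08-22.  No existing file touched.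
-/

noncomputable section

open scoped BigOperators Matrix
open Finset

namespace Summit.QuantumFields.BalabanUV.Beta.PeriodisedIndexLawSummable

open Literature.MathematicalPhysics.QuantumFieldTheory
open Literature.MathematicalPhysics.QuantumFieldTheory.Balaban1983to89
open Literature.MathematicalPhysics.QuantumFieldTheory.Balaban1983to89.Beta
open B12Sec2to5 (l1 l1_nonneg)
open B4TorusKernel.MultiPeriod (translate translate_apply)
open B6Lemma24Torus (pbox)
open ExpKernelCalculus (MKer Decays BiLoc shiftK summable_exp_shift l1_sub_symm)
open AffineAveraging (Site box toSite unitVec dz)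
open KernelWard (divV)
open OneStepResolventKernel (Fib)
open Summit.QuantumFields.BalabanUV.Beta.FP.KernelPeriodisationFib (Idx perF perF_apply perZ perZ_apply trF perF_transpose summable_translate_of_decays)
open Summit.QuantumFields.BalabanUV.Beta.FP.KernelPeriodisationFibLoc (dper dper_apply dper_translate decays_dper_diag summable_exp_l1_translate)
open Summit.QuantumFields.BalabanUV.Beta.FP.KernelPeriodisationFibTrace (tsum_sites_eq_sum_tsum)
open Summit.QuantumFields.BalabanUV.Beta.FP.PeriodisedBorderTables (dper_apply_of_blockCov)
open Summit.QuantumFields.BalabanUV.Beta.FP.TorusGaugeCovariance (tdelta tdelta_apply tdelta_translate tgrad tgrad_inl)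
open Summit.QuantumFields.BalabanUV.Beta.FP.PeriodisedWardOrderZero (abs_tdelta_le)
open Summit.QuantumFields.BalabanUV.Beta.GAN24.BorderGaugeLegContact (tsum_mul_ite_sub_ite_mul)

variable {d : ℕ}

/-! ## §1 A block-covariant, exponentially LOCALISED table family with an index-slot law, inserted along a torus pure gauge (the ℓ¹ twin of
`PeriodisedBorderIndexWard` §1) -/

section Generic

variable {F : Type*} {M M' : Fin (d + 1) → ℕ} [∀ μ, NeZero (M μ)] {N : ℕ}
  (V : Fin (d + 1) → Site (d + 1) → MKer (d + 1) F) (q : MKer (d + 1) F) (p₁ : Site (d + 1) → Site (d + 1)) (a b : F)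

omit [∀ μ, NeZero (M μ)] in
/-- [folklore] **SUMMATION BY PARTS OVER THE LATTICE, ℓ¹ FAMILY × BOUNDED POTENTIAL**: for `G α` summable (every `α`) and `|ψ| ≤ B`,
`Σ'_x Σ_α (ψ(x + e_α) − ψ x)·G α x = Σ'_x ψ x · Σ_α (G α (x − e_α) − G α x)` (gan24-p2's `tsum_sum_dz_mul_eq` with its «summable against every
potential» hypothesis — finite support in disguise — weakened to what an exponentially localised family has). -/
theorem tsum_sum_dz_mul_eq_of_bdd (G : Fin (d + 1) → Site (d + 1) → ℝ) (hG : ∀ α, Summable (G α))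
    (ψ : Site (d + 1) → ℝ) {B : ℝ} (hψ : ∀ x, |ψ x| ≤ B) :
    ∑' x, ∑ α, dz ψ α x * G α x = ∑' x, ψ x * ∑ α, (G α (x - unitVec α) - G α x) := by
  have hb : ∀ φ : Site (d + 1) → ℝ, (∀ x, |φ x| ≤ B) → ∀ α, Summable fun x => φ x * G α x := fun φ hφ α =>
    ((hG α).abs.mul_left B).of_norm_bounded fun x => by
      rw [Real.norm_eq_abs, abs_mul]
      exact mul_le_mul_of_nonneg_right (hφ x) (abs_nonneg _)
  have hs1 : ∀ α, Summable fun x => ψ (x + unitVec α) * G α x := fun α => hb _ (fun x => hψ _) α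
  have hs2 : ∀ α, Summable fun x => ψ x * G α x := hb ψ hψ
  have hs3 : ∀ α, Summable fun x => ψ x * G α (x - unitVec α) := fun α => by
    refine ((Equiv.subRight (unitVec α)).summable_iff.2 (hs1 α)).congr fun x => ?_
    simp only [Function.comp_apply, Equiv.subRight_apply, sub_add_cancel]
  have hshift : ∀ α, ∑' x, ψ (x + unitVec α) * G α x = ∑' x, ψ x * G α (x - unitVec α) := fun α => by
    rw [← (Equiv.subRight (unitVec α)).tsum_eq (fun x => ψ (x + unitVec α) * G α x)]
    exact tsum_congr fun x => by simp only [Equiv.subRight_apply, sub_add_cancel]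
  have hL : ∀ x, ∑ α, dz ψ α x * G α x = ∑ α, (ψ (x + unitVec α) * G α x - ψ x * G α x) := fun x =>
    Finset.sum_congr rfl fun α _ => by rw [dz]; ring
  have hR : ∀ x, ψ x * ∑ α, (G α (x - unitVec α) - G α x) = ∑ α, (ψ x * G α (x - unitVec α) - ψ x * G α x) := fun x => by
    rw [Finset.mul_sum]
    exact Finset.sum_congr rfl fun α _ => by ring
  rw [tsum_congr hL, tsum_congr hR, Summable.tsum_finsetSum (fun α _ => (hs1 α).sub (hs2 α)),
    Summable.tsum_finsetSum (fun α _ => (hs3 α).sub (hs2 α))]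
  refine Finset.sum_congr rfl fun α _ => ?_
  rw [(hs1 α).tsum_sub (hs2 α), (hs3 α).tsum_sub (hs2 α), hshift α]

omit [∀ μ, NeZero (M μ)] in
/-- [folklore] **THE LATTICE INSERTION OF A PURE GAUGE, BY PARTS IN THE FAMILY INDEX — ℓ¹ VERSION**: with the family index sum ABSOLUTELY CONVERGENT at
the fluctuation pair `(x, z)` (`hT`) and the index-slot law `Σ_κ (V κ (w − e_κ) − V κ w) x z a b = ([p₁ x = w] − [z = w]) · q x z a b` (`hlaw`), for
every BOUNDED potential `ψ`: `Σ'_u Σ_κ (ψ (u + e_κ) − ψ u) · V κ u x z a b = (ψ (p₁ x) − ψ z) · q x z a b`. -/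
theorem tsum_sum_dz_mul_family_of_indexLaw_summable (x z : Site (d + 1))
    (hT : ∀ κ, Summable fun u => V κ u x z a b)
    (hlaw : ∀ w : Site (d + 1), ∑ κ, (V κ (w - unitVec κ) x z a b - V κ w x z a b)
      = ((if p₁ x = w then (1 : ℝ) else 0) - (if z = w then 1 else 0)) * q x z a b)
    (ψ : Site (d + 1) → ℝ) {B : ℝ} (hψ : ∀ w, |ψ w| ≤ B) :
    ∑' u, ∑ κ, dz ψ κ u * V κ u x z a b = (ψ (p₁ x) - ψ z) * q x z a b := by
  rw [tsum_sum_dz_mul_eq_of_bdd (fun κ u => V κ u x z a b) hT ψ hψ]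
  simp only [hlaw]
  exact tsum_mul_ite_sub_ite_mul ψ (p₁ x) z (q x z a b)

omit [∀ μ, NeZero (M μ)] in
/-- the lattice gradient of the torus indicator is bounded by two (leaf-05's `PeriodisedWardOrderZero.abs_tdelta_le`, twice). -/
theorem abs_dz_tdelta_le (s : ↥(pbox M)) (κ : Fin (d + 1)) (w : Site (d + 1)) : |dz (fun w => tdelta M w s) κ w| ≤ 2 := by
  rw [dz]
  have h1 := abs_tdelta_le M (w + unitVec κ) s
  have h2 := abs_tdelta_le M w s
  calc |tdelta M (w + unitVec κ) s - tdelta M w s| ≤ |tdelta M (w + unitVec κ) s| + |tdelta M w s| := abs_sub _ _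
    _ ≤ 2 := by linarith

omit [∀ μ, NeZero (M μ)] in
/-- the one-sided decay of a localised member as a function of its bond: `|V κ u x z a b| ≤ C·e^{−δ|x−u|₁}`. -/
theorem abs_apply_le_of_biLoc {C δ : ℝ} (hV : ∀ κ u, BiLoc (V κ u) u u C δ) (hC : 0 ≤ C) (hδ : 0 ≤ δ)
    (κ : Fin (d + 1)) (u x z : Site (d + 1)) : |V κ u x z a b| ≤ C * Real.exp (-δ * l1 (x - u)) := by
  refine (hV κ u x z a b).trans (mul_le_mul_of_nonneg_left ?_ hC)
  rw [Real.exp_le_exp]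
  nlinarith [l1_nonneg (z - u), l1_nonneg (x - u)]

/-- [folklore] **THE TORUS INSERTION (family index on the box, copies summed by `dper`) OF A TORUS PURE GAUGE, at one lattice fluctuation site —
ℓ¹ VERSION**: for a block-covariant family (`hVt`, scale `N`, period `M = N·M′`) exponentially bi-localised at its bond (`hV`), with the index-slot law
`hlaw`: `Σ_{u ∈ pbox M} Σ_κ tgrad M (u, inl κ) s · dper M (V κ u) x z a b = (tdelta M (p₁ x) s − tdelta M z s) · q x z a b`
(leaf-05's `sum_tgrad_mul_dper_of_indexLaw` with finite support `hT` replaced by localisation; the two exchanges are Fubini for an ℓ¹ family). -/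
theorem sum_tgrad_mul_dper_of_indexLaw_summable (hM : ∀ i, M i = N * M' i)
    (hVt : ∀ (κ : Fin (d + 1)) (u t : Site (d + 1)), V κ (u + (N : ℤ) • t) = shiftK (-((N : ℤ) • t)) (V κ u))
    {C δ : ℝ} (hV : ∀ κ u, BiLoc (V κ u) u u C δ) (hC : 0 ≤ C) (hδ : 0 < δ)
    (hlaw : ∀ (w x z : Site (d + 1)), ∑ κ, (V κ (w - unitVec κ) x z a b - V κ w x z a b)
      = ((if p₁ x = w then (1 : ℝ) else 0) - (if z = w then 1 else 0)) * q x z a b)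
    (s : ↥(pbox M)) (x z : Site (d + 1)) :
    ∑ u : ↥(pbox M), ∑ κ : Fin (d + 1), tgrad M (u, Sum.inl κ) s * dper M (V κ (u : Site (d + 1))) x z a b
      = (tdelta M (p₁ x) s - tdelta M z s) * q x z a b := by
  have hVu := abs_apply_le_of_biLoc V a b hV hC hδ.le
  -- the summand as a function of the lattice family index, unfolded along box × period lattice
  set H : Site (d + 1) → ℝ := fun u => ∑ κ, dz (fun w => tdelta M w s) κ u * V κ u x z a b with hH
  have hbd : ∀ (κ : Fin (d + 1)) (u : Site (d + 1)),
      |dz (fun w => tdelta M w s) κ u * V κ u x z a b| ≤ 2 * C * Real.exp (-δ * l1 (x - u)) := fun κ u => by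
    rw [abs_mul]
    calc |dz (fun w => tdelta M w s) κ u| * |V κ u x z a b| ≤ 2 * (C * Real.exp (-δ * l1 (x - u))) :=
          mul_le_mul (abs_dz_tdelta_le s κ u) (hVu κ u x z) (abs_nonneg _) (by norm_num)
      _ = 2 * C * Real.exp (-δ * l1 (x - u)) := by ring
  have hHs : Summable H := by
    refine ((summable_exp_shift hδ x).mul_left (∑ _κ : Fin (d + 1), 2 * C)).of_norm_bounded fun u => ?_
    rw [Real.norm_eq_abs, hH, Finset.sum_mul]
    exact (Finset.abs_sum_le_sum_abs _ _).trans (Finset.sum_le_sum fun κ _ => hbd κ u)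
  have hterm : ∀ (u : ↥(pbox M)) (κ : Fin (d + 1)),
      tgrad M (u, Sum.inl κ) s * dper M (V κ (u : Site (d + 1))) x z a b
        = ∑' m : Site (d + 1), dz (fun w => tdelta M w s) κ (translate M (u : Site (d + 1)) m)
            * V κ (translate M (u : Site (d + 1)) m) x z a b := fun u κ => by
    rw [dper_apply_of_blockCov hM hVt κ (u : Site (d + 1)) x z a b, ← tsum_mul_left]
    refine tsum_congr fun m => ?_
    congr 1
    simp only [tgrad_inl, dz]
    rw [show translate M (u : Site (d + 1)) m + unitVec κ = translate M ((u : Site (d + 1)) + unitVec κ) m by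
        funext i; simp only [B4TorusKernel.MultiPeriod.translate_apply, Pi.add_apply]; ring, tdelta_translate, tdelta_translate]
  have hswap : ∀ u : ↥(pbox M), ∑ κ : Fin (d + 1), tgrad M (u, Sum.inl κ) s * dper M (V κ (u : Site (d + 1))) x z a b
      = ∑' m : Site (d + 1), H (translate M (u : Site (d + 1)) m) := fun u => by
    rw [Finset.sum_congr rfl fun κ _ => hterm u κ, ← Summable.tsum_finsetSum]
    intro κ _
    obtain ⟨hs, -⟩ := summable_exp_l1_translate M hδ x (u : Site (d + 1))
    refine (hs.mul_left (2 * C)).of_norm_bounded fun m => ?_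
    rw [Real.norm_eq_abs, l1_sub_symm]
    exact hbd κ _
  rw [Finset.sum_congr rfl fun u _ => hswap u, ← tsum_sites_eq_sum_tsum M hHs, hH]
  exact tsum_sum_dz_mul_family_of_indexLaw_summable V q p₁ a b x z
    (fun κ => ((summable_exp_shift hδ x).mul_left C).of_norm_bounded fun u => by rw [Real.norm_eq_abs]; exact hVu κ u x z)
    (fun w => hlaw w x z) (fun w => tdelta M w s) (fun w => abs_tdelta_le M w s)

/-- [folklore] **… AND PERIODISED IN THE FLUCTUATION SLOT — ℓ¹ VERSION** (NO hypothesis on the contact kernel `q`: its period sum leaves the constant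
by `tsum_mul_left` whether or not it converges; `p₁` as in leaf-05: the contact point is a LATTICE function of `x` only): for every torus gauge parameter `s`,
`Σ_{u ∈ pbox M} Σ_κ tgrad M (u, inl κ) s · perZ M (dper M (V κ u)) x z a b = (tdelta M (p₁ x) s − tdelta M z s) · perZ M q x z a b`. -/
theorem sum_tgrad_mul_perZ_dper_of_indexLaw_summable (hM : ∀ i, M i = N * M' i)
    (hVt : ∀ (κ : Fin (d + 1)) (u t : Site (d + 1)), V κ (u + (N : ℤ) • t) = shiftK (-((N : ℤ) • t)) (V κ u))
    {C δ : ℝ} (hV : ∀ κ u, BiLoc (V κ u) u u C δ) (hC : 0 ≤ C) (hδ : 0 < δ)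
    (hlaw : ∀ (w x z : Site (d + 1)), ∑ κ, (V κ (w - unitVec κ) x z a b - V κ w x z a b)
      = ((if p₁ x = w then (1 : ℝ) else 0) - (if z = w then 1 else 0)) * q x z a b)
    (s : ↥(pbox M)) (x z : Site (d + 1)) :
    ∑ u : ↥(pbox M), ∑ κ : Fin (d + 1), tgrad M (u, Sum.inl κ) s * perZ M (dper M (V κ (u : Site (d + 1)))) x z a b
      = (tdelta M (p₁ x) s - tdelta M z s) * perZ M q x z a b := by
  have hM1 : ∀ i, 1 ≤ M i := fun i => Nat.one_le_iff_ne_zero.2 (NeZero.ne _)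
  -- the period sum of each periodised member converges (the periodised insertion decays)
  have hsm : ∀ (κ : Fin (d + 1)) (u : Site (d + 1)), Summable fun m : Site (d + 1) => dper M (V κ u) x (translate M z m) a b :=
    fun κ u => summable_translate_of_decays (decays_dper_diag M (hV κ u) hC hδ)
      (mul_nonneg hC (B4Sect5Proof.latticeConst_nonneg _ (half_pos hδ).le)) (half_pos hδ) hM1 x z a b
  have h1 : ∀ u : ↥(pbox M), ∑ κ : Fin (d + 1), tgrad M (u, Sum.inl κ) s * perZ M (dper M (V κ (u : Site (d + 1)))) x z a b
      = ∑' m : Site (d + 1), ∑ κ : Fin (d + 1), tgrad M (u, Sum.inl κ) s * dper M (V κ (u : Site (d + 1))) x (translate M z m) a b := fun u => by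
    rw [Summable.tsum_finsetSum (fun κ _ => (hsm κ _).mul_left _)]
    exact Finset.sum_congr rfl fun κ _ => by rw [perZ_apply, tsum_mul_left]
  rw [Finset.sum_congr rfl fun u _ => h1 u, ← Summable.tsum_finsetSum (fun u _ => summable_sum fun κ _ => (hsm κ _).mul_left _)]
  have h2 : ∀ m : Site (d + 1), ∑ u : ↥(pbox M), ∑ κ : Fin (d + 1), tgrad M (u, Sum.inl κ) s * dper M (V κ (u : Site (d + 1))) x (translate M z m) a b
      = (tdelta M (p₁ x) s - tdelta M z s) * q x (translate M z m) a b := fun m => by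
    rw [sum_tgrad_mul_dper_of_indexLaw_summable V q p₁ a b hM hVt hV hC hδ hlaw s x (translate M z m), tdelta_translate]
  rw [tsum_congr h2, tsum_mul_left, perZ_apply]

/-- [folklore] **GAUGE-NULL FAMILIES**: if the index-slot law has NO contact (`Σ_κ (V κ (w − e_κ) − V κ w) = 0` as kernels, e.g. an1's `divV V w = 0`),
then `Σ_{u ∈ pbox M} Σ_κ tgrad M (u, inl κ) s · perZ M (dper M (V κ u)) x z a b = 0`. -/
theorem sum_tgrad_mul_perZ_dper_eq_zero_of_divV_eq_zero [Fintype F] (hM : ∀ i, M i = N * M' i)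
    (hVt : ∀ (κ : Fin (d + 1)) (u t : Site (d + 1)), V κ (u + (N : ℤ) • t) = shiftK (-((N : ℤ) • t)) (V κ u))
    {C δ : ℝ} (hV : ∀ κ u, BiLoc (V κ u) u u C δ) (hC : 0 ≤ C) (hδ : 0 < δ) (hdiv : ∀ w : Site (d + 1), divV V w = 0)
    (s : ↥(pbox M)) (x z : Site (d + 1)) :
    ∑ u : ↥(pbox M), ∑ κ : Fin (d + 1), tgrad M (u, Sum.inl κ) s * perZ M (dper M (V κ (u : Site (d + 1)))) x z a b = 0 := by
  -- the two unit-vector conventions agree (an1's `KernelWard.divV` is written with `B6BondElimination.unitVec`)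
  have hu : ∀ κ : Fin (d + 1), (B6BondElimination.unitVec κ : Site (d + 1)) = unitVec κ := fun κ => by
    funext i
    simp only [B6BondElimination.unitVec, AffineAveraging.unitVec, Pi.single_apply]
  have hlaw : ∀ (w x z : Site (d + 1)), ∑ κ, (V κ (w - unitVec κ) x z a b - V κ w x z a b)
      = ((if x = w then (1 : ℝ) else 0) - (if z = w then 1 else 0)) * (0 : MKer (d + 1) F) x z a b := fun w x z => by
    have h := congrFun (congrFun (congrFun (congrFun (hdiv w) x) z) a) b
    simp only [KernelWard.divV, Finset.sum_apply, Pi.sub_apply, hu, Pi.zero_apply] at h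
    rw [h, Pi.zero_apply, Pi.zero_apply, Pi.zero_apply, Pi.zero_apply, mul_zero]
  rw [sum_tgrad_mul_perZ_dper_of_indexLaw_summable V 0 id a b hM hVt hV hC hδ hlaw s x z]
  simp [perZ_apply]

omit [∀ μ, NeZero (M μ)] in
/-- [folklore] **A FIBRE-TRANSPOSE-ODD MEMBER PERIODISES TO AN ANTISYMMETRIC MATRIX**: `trF K = −K ⟹ (perF M (dper M K))ᵀ = −perF M (dper M K)`
(leaf-05's `perF_dper_wilsonA_transpose`, generic; gan24-p3's `perF_transpose` + `dper_translate`; no summability — `dper` translates both slots alike). -/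
theorem perF_dper_transpose_of_trF [Fintype F] [DecidableEq F] (K : MKer (d + 1) F) (hK : trF K = -K) :
    (perF M (dper M K))ᵀ = -perF M (dper M K) := by
  have h : trF (dper M K) = -dper M K := by
    funext x y a' b'
    simp only [trF, Pi.neg_apply, dper_apply, ← tsum_neg]
    refine tsum_congr fun m => ?_
    have := congrFun (congrFun (congrFun (congrFun hK (translate M x m)) (translate M y m)) a') b'
    simpa only [trF, Pi.neg_apply] using this
  rw [← perF_transpose M (fun m x y a' b' => dper_translate M K m x y a' b'), h]
  ext p q'
  simp only [perF_apply, Matrix.neg_apply, perZ_apply, Pi.neg_apply, tsum_neg]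

/-- [folklore] **THE (β) DOOR's `hΛ` SHAPE FOR ANY GAUGE-NULL LOCALISED FAMILY** (`F`-fibre `Fib d`): with `Λ b := w • (perF M (dper M (V b.2 ↑b.1)))∘(ff)`
(`b = (u, κ)` a torus bond, any weight `w`), block covariance at scale `N`, `M = N·M′`, localisation and `divV V ≡ 0`:
`Σ_b (Σ_s tgrad M (b.1, inl b.2) s · λ s) • Λ b = 0` for every torus gauge function `λ`. -/
theorem torus_indexLaw_ff_of_divV_eq_zero (W : Fin (d + 1) → Site (d + 1) → MKer (d + 1) (Fib d)) (hM : ∀ i, M i = N * M' i)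
    (hWt : ∀ (κ : Fin (d + 1)) (u t : Site (d + 1)), W κ (u + (N : ℤ) • t) = shiftK (-((N : ℤ) • t)) (W κ u))
    {C δ : ℝ} (hW : ∀ κ u, BiLoc (W κ u) u u C δ) (hC : 0 ≤ C) (hδ : 0 < δ) (hdiv : ∀ w : Site (d + 1), divV W w = 0)
    (w : ℝ) (lam : ↥(pbox M) → ℝ) :
    ∑ b : ↥(pbox M) × Fin (d + 1), (∑ s : ↥(pbox M), tgrad M (b.1, Sum.inl b.2) s * lam s) •
        (w • (perF M (dper M (W b.2 (b.1 : Site (d + 1))))).submatrix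
          (fun b : ↥(pbox M) × Fin (d + 1) => ((b.1, Sum.inl b.2) : Idx M (Fib d)))
          (fun b : ↥(pbox M) × Fin (d + 1) => ((b.1, Sum.inl b.2) : Idx M (Fib d))))
      = 0 := by
  ext p q'
  simp only [Matrix.sum_apply, Matrix.smul_apply, Matrix.submatrix_apply, perF_apply, Matrix.zero_apply, smul_eq_mul]
  rw [Fintype.sum_prod_type]
  have hre : ∀ u : ↥(pbox M), ∑ κ : Fin (d + 1), (∑ s : ↥(pbox M), tgrad M (u, Sum.inl κ) s * lam s)
        * (w * perZ M (dper M (W κ (u : Site (d + 1)))) (p.1 : Site (d + 1)) (q'.1 : Site (d + 1)) (Sum.inl p.2) (Sum.inl q'.2))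
      = ∑ s : ↥(pbox M), ∑ κ : Fin (d + 1), (lam s * w) * (tgrad M (u, Sum.inl κ) s
        * perZ M (dper M (W κ (u : Site (d + 1)))) (p.1 : Site (d + 1)) (q'.1 : Site (d + 1)) (Sum.inl p.2) (Sum.inl q'.2)) := fun u => by
    simp only [Finset.sum_mul]
    rw [Finset.sum_comm]
    exact Finset.sum_congr rfl fun s _ => Finset.sum_congr rfl fun κ _ => by ring
  rw [Finset.sum_congr rfl fun u _ => hre u, Finset.sum_comm]
  refine Finset.sum_eq_zero fun s _ => ?_
  rw [Finset.sum_congr rfl fun u _ => (Finset.mul_sum _ _ _).symm, ← Finset.mul_sum,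
    sum_tgrad_mul_perZ_dper_eq_zero_of_divV_eq_zero W (Sum.inl p.2) (Sum.inl q'.2) hM hWt hW hC hδ hdiv s _ _, mul_zero]

end Generic

end Summit.QuantumFields.BalabanUV.Beta.PeriodisedIndexLawSummable

end
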